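import Summits.AnomalousDissipation.AnomalousDissipation.Theorems.ScalarAnomalySteadySourceFormal.Negative.ColdStartCeiling
import Literature.Analysis.FluidPDE.PassiveScalarEnergySlice
import Literature.Analysis.FluidPDE.TurbWave0
import HarnessLib

/-!
# Candidate proof of `stub_dissipationFromPower` (S4 of line `budgeted-mixer-template`,
crux `TwoAndHalfD.ScalarAnomalySteadySourceFormal`, stmt-AnomalousDissipation-0448)

drefute seat — NOT landed by the refuter (stubs are the lead's to land); attached as item
evidence. Registered stub signature VERBATIM (skeleton sha 7c4ef97a32c5). Proof = power equals
dissipation in the mean: the forced `L²` balance (`hasDerivWithinAt_scalarL2Sq_forced`) integrated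
on `[0, T]`, `T⁻¹∫₀ᵀ κ‖∇θ‖² = T⁻¹∫₀ᵀ (h, θ) - (‖θ(T)‖² - ‖θ(0)‖²)/(2T) ≥ e - C/T`, bounded means,
`limsup ≥ e - δ` for every `δ > 0`.
-/

open MeasureTheory Set Filter
open _root_.Topology
open scoped InnerProductSpace

noncomputable section

namespace Summit.AnomalousDissipation.AnomalousDissipation.Theorems.ScalarAnomalySteadySourceFormal.Negative

open Literature.Analysis Literature.Analysis.FunctionSpaces
open Literature.Analysis.FluidPDE Literature.Analysis.FluidPDE.Torus

set_option linter.dupNamespace false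

/-- **`stub_dissipationFromPower` (S4) — candidate proof, registered signature verbatim.** [folklore] -/
theorem stub_dissipationFromPower_proof :
    ∀ (κ B e t₀ : ℝ) (u : ℝ → UnitAddTorus (Fin 2) → EuclideanSpace ℝ (Fin 2))
      (h : UnitAddTorus (Fin 2) → ℝ) (θ : ℝ → UnitAddTorus (Fin 2) → ℝ),
      0 ≤ κ →
      Torus.IsClassicalScalarTransportForcedOn (Set.Ici 0) κ u (fun _ => h) θ →
      (∀ t, 0 ≤ t → Torus.scalarL2Sq (θ t) ≤ B) →
      (∀ t, t₀ ≤ t → e ≤ ∫ x, h x * θ t x) →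
      e ≤ longTimeAvgSup (fun t => κ * (Torus.eScalarGradNormSq (θ t)).toReal) := by
  intro κ B e t₀ u h θ hκ hθ hBd hfloor
  -- notation
  set L : ℝ → ℝ := fun t => scalarL2Sq (θ t) with hL
  set G : ℝ → ℝ := fun t => scalarGradNormSq (θ t) with hG
  set P : ℝ → ℝ := fun t => ∫ x, h x * θ t x with hP
  set D : ℝ → ℝ := fun t => κ * (eScalarGradNormSq (θ t)).toReal with hD
  have hB0 : 0 ≤ B := le_trans (scalarL2Sq_nonneg _) (hBd 0 le_rfl)
  have hh : FunctionSpaces.Torus.IsSmooth h := by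
    have := hθ.smooth_source.isSmooth_slice (Set.self_mem_Ici : (0:ℝ) ∈ Ici (0:ℝ))
    simpa using this
  set N : ℝ := Real.sqrt (scalarL2Sq h) with hN
  set sB : ℝ := Real.sqrt B with hsB
  have hN0 : 0 ≤ N := Real.sqrt_nonneg _
  have hsB0 : 0 ≤ sB := Real.sqrt_nonneg _
  have hU : UniqueDiffOn ℝ (Ici (0 : ℝ)) := uniqueDiffOn_Ici 0
  -- slices and pointwise identities
  have hslice : ∀ t, 0 ≤ t → FunctionSpaces.Torus.IsSmooth (θ t) := fun t ht =>
    hθ.smooth_scalar.isSmooth_slice (show t ∈ Ici (0:ℝ) from ht)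
  have hDG : ∀ t, 0 ≤ t → D t = κ * G t := by
    intro t ht
    simp only [hD, hG]
    rw [scalarGradNormSq_eq_toReal_holds (hslice t ht)]
  have hPbd : ∀ t, 0 ≤ t → |P t| ≤ N * sB := by
    intro t ht
    have hθt := hslice t ht
    have hup : P t ≤ N * Real.sqrt (L t) := integral_mul_le_sqrt_scalarL2Sq hh hθt
    have hlo : -(N * Real.sqrt (L t)) ≤ P t := by
      have hneg : FunctionSpaces.Torus.IsSmooth (fun x => -θ t x) := hθt.neg
      have hcs := integral_mul_le_sqrt_scalarL2Sq hh hneg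
      have hsq : scalarL2Sq (fun x => -θ t x) = L t := by simp only [hL, scalarL2Sq, neg_sq]
      rw [hsq] at hcs
      have hint : ∫ x, h x * (fun x => -θ t x) x = -P t := by
        simp only [hP]
        rw [← integral_neg]
        refine integral_congr_ae (ae_of_all _ fun x => ?_)
        simp only [mul_neg]
      rw [hint] at hcs
      linarith
    have hroot : Real.sqrt (L t) ≤ sB := Real.sqrt_le_sqrt (hBd t ht)
    have h1 : N * Real.sqrt (L t) ≤ N * sB := mul_le_mul_of_nonneg_left hroot hN0
    rw [abs_le]
    constructor <;> linarith
  -- the forced balance and continuity of the three observables on `Ici 0`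
  have hderiv : ∀ t ∈ Ici (0:ℝ), HasDerivWithinAt L (-(2 * κ) * G t + 2 * P t) (Ici 0) t :=
    fun t ht => hasDerivWithinAt_scalarL2Sq_forced hθ (convex_Ici 0) ht
  have hLc : ContinuousOn L (Ici 0) := fun t ht => (hderiv t ht).continuousWithinAt
  have hGc : ContinuousOn G (Ici 0) := by
    have hg := hθ.smooth_scalar.gradient hU
    have hφ : FunctionSpaces.Torus.IsSmoothSpaceTimeOn (Ici (0:ℝ))
        (fun t x => ⟪FunctionSpaces.Torus.gradient (θ t) x, FunctionSpaces.Torus.gradient (θ t) x⟫_ℝ) :=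
      hg.inner hg
    have hc := hφ.continuousOn_integral (convex_Ici 0)
    refine hc.congr fun t _ => ?_
    simp only [hG, scalarGradNormSq, real_inner_self_eq_norm_sq]
  have hPc : ContinuousOn P (Ici 0) := by
    have hφ : FunctionSpaces.Torus.IsSmoothSpaceTimeOn (Ici (0:ℝ)) (fun t x => h x * θ t x) :=
      (FunctionSpaces.Torus.isSmoothSpaceTimeOn_const hh _).mul hθ.smooth_scalar
    exact hφ.continuousOn_integral (convex_Ici 0)
  have hFc : ContinuousOn (fun t => -(2 * κ) * G t + 2 * P t) (Ici 0) :=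
    (continuousOn_const.mul hGc).add (continuousOn_const.mul hPc)
  -- interval integrability on sub-windows of `Ici 0`
  have hii : ∀ {f : ℝ → ℝ}, ContinuousOn f (Ici 0) → ∀ a b : ℝ, 0 ≤ a → a ≤ b →
      IntervalIntegrable f volume a b := by
    intro f hf a b ha hab
    refine (hf.mono ?_).intervalIntegrable
    rw [uIcc_of_le hab]
    exact fun t ht => le_trans ha ht.1
  -- the integrated balance on `[0, T]`
  have hFTC : ∀ T, 0 < T → κ * ∫ t in (0:ℝ)..T, G t = (∫ t in (0:ℝ)..T, P t) - (L T - L 0) / 2 := by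
    intro T hT
    have h1 : ∫ t in (0:ℝ)..T, (-(2 * κ) * G t + 2 * P t) = L T - L 0 :=
      intervalIntegral.integral_eq_sub_of_hasDerivAt_of_le hT.le (hLc.mono Icc_subset_Ici_self)
        (fun t ht => (hderiv t (le_of_lt ht.1)).hasDerivAt (Ici_mem_nhds ht.1))
        (hii hFc 0 T le_rfl hT.le)
    have h2 : ∫ t in (0:ℝ)..T, (-(2 * κ) * G t + 2 * P t) =
        -(2 * κ) * (∫ t in (0:ℝ)..T, G t) + 2 * ∫ t in (0:ℝ)..T, P t := by
      rw [intervalIntegral.integral_add ((hii hGc 0 T le_rfl hT.le).const_mul _)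
        ((hii hPc 0 T le_rfl hT.le).const_mul _), intervalIntegral.integral_const_mul,
        intervalIntegral.integral_const_mul]
    rw [h2] at h1
    linarith
  have hDint : ∀ T, 0 < T → ∫ t in (0:ℝ)..T, D t = κ * ∫ t in (0:ℝ)..T, G t := by
    intro T hT
    rw [← intervalIntegral.integral_const_mul]
    refine intervalIntegral.integral_congr fun t ht => ?_
    rw [uIcc_of_le hT.le] at ht
    exact hDG t ht.1
  -- bounds on `∫₀ᵀ P`
  set t₁ : ℝ := max t₀ 0 with ht₁
  have ht₁0 : 0 ≤ t₁ := le_max_right _ _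
  have hPupper : ∀ T, 0 < T → ∫ t in (0:ℝ)..T, P t ≤ N * sB * T := by
    intro T hT
    have hm := intervalIntegral.integral_mono_on hT.le (hii hPc 0 T le_rfl hT.le)
      (hii continuousOn_const 0 T le_rfl hT.le : IntervalIntegrable (fun _ => N * sB) volume 0 T)
      (fun t ht => (abs_le.1 (hPbd t ht.1)).2)
    rw [intervalIntegral.integral_const, smul_eq_mul] at hm
    linarith
  have hPlower : ∀ T, t₁ ≤ T → e * T - (N * sB * t₁ + e * t₁) ≤ ∫ t in (0:ℝ)..T, P t := by
    intro T hT
    have hT0 : 0 ≤ T := le_trans ht₁0 hT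
    have hsplit := intervalIntegral.integral_add_adjacent_intervals (hii hPc 0 t₁ le_rfl ht₁0)
      (hii hPc t₁ T ht₁0 hT)
    have hm1 := intervalIntegral.integral_mono_on ht₁0
      (hii continuousOn_const 0 t₁ le_rfl ht₁0 : IntervalIntegrable (fun _ => -(N * sB)) volume 0 t₁)
      (hii hPc 0 t₁ le_rfl ht₁0) (fun t ht => (abs_le.1 (hPbd t ht.1)).1)
    have hm2 := intervalIntegral.integral_mono_on hT
      (hii continuousOn_const t₁ T ht₁0 hT : IntervalIntegrable (fun _ => e) volume t₁ T)
      (hii hPc t₁ T ht₁0 hT) (fun t ht => hfloor t (le_trans (le_max_left _ _) ht.1))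
    rw [intervalIntegral.integral_const, smul_eq_mul] at hm1 hm2
    rw [← hsplit]
    nlinarith
  -- the time means of `D`
  have hmean : ∀ T, 0 < T → timeMean D T = T⁻¹ * ((∫ t in (0:ℝ)..T, P t) - (L T - L 0) / 2) := by
    intro T hT
    unfold timeMean
    rw [hDint T hT, hFTC T hT]
  have hL0 : 0 ≤ L 0 := scalarL2Sq_nonneg _
  have hupper : ∀ T, 1 ≤ T → timeMean D T ≤ N * sB + L 0 / 2 := by
    intro T hT
    have hT0 : 0 < T := by linarith
    rw [hmean T hT0]
    have hLT : 0 ≤ L T := scalarL2Sq_nonneg _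
    have h1 : (∫ t in (0:ℝ)..T, P t) - (L T - L 0) / 2 ≤ N * sB * T + L 0 / 2 := by
      have := hPupper T hT0
      linarith
    have hTinv : 0 < T⁻¹ := inv_pos.2 hT0
    calc T⁻¹ * ((∫ t in (0:ℝ)..T, P t) - (L T - L 0) / 2) ≤ T⁻¹ * (N * sB * T + L 0 / 2) :=
          mul_le_mul_of_nonneg_left h1 hTinv.le
      _ = N * sB + T⁻¹ * (L 0 / 2) := by field_simp
      _ ≤ N * sB + 1 * (L 0 / 2) := by
          gcongr
          exact inv_le_one_of_one_le₀ hT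
      _ = N * sB + L 0 / 2 := by ring
  set C : ℝ := |N * sB * t₁ + e * t₁ + B / 2| with hC
  have hC0 : 0 ≤ C := abs_nonneg _
  have hlower : ∀ T, 0 < T → t₁ ≤ T → e - C / T ≤ timeMean D T := by
    intro T hT hT1
    rw [hmean T hT]
    have hLT : L T ≤ B := hBd T hT.le
    have h1 : e * T - (N * sB * t₁ + e * t₁ + B / 2) ≤ (∫ t in (0:ℝ)..T, P t) - (L T - L 0) / 2 := by
      have := hPlower T hT1
      linarith
    have h2 : e * T - C ≤ (∫ t in (0:ℝ)..T, P t) - (L T - L 0) / 2 :=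
      le_trans (by linarith [le_abs_self (N * sB * t₁ + e * t₁ + B / 2)]) h1
    have hTinv : 0 < T⁻¹ := inv_pos.2 hT
    calc e - C / T = T⁻¹ * (e * T - C) := by field_simp
      _ ≤ T⁻¹ * ((∫ t in (0:ℝ)..T, P t) - (L T - L 0) / 2) := mul_le_mul_of_nonneg_left h2 hTinv.le
  -- limsup bookkeeping
  have hbdd : IsBoundedUnder (· ≤ ·) atTop (timeMean D) :=
    ⟨N * sB + L 0 / 2, (eventually_ge_atTop 1).mono fun T hT => hupper T hT⟩
  change e ≤ limsup (timeMean D) atTop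
  refine le_of_forall_sub_le fun δ hδ => ?_
  have hev : ∀ᶠ T in atTop, e - δ ≤ timeMean D T := by
    have hCT : Tendsto (fun T : ℝ => C / T) atTop (𝓝 0) := tendsto_const_nhds.div_atTop tendsto_id
    filter_upwards [eventually_gt_atTop (0:ℝ), eventually_ge_atTop t₁,
      hCT.eventually (gt_mem_nhds hδ)] with T hT hT1 hCδ
    have := hlower T hT hT1
    linarith
  exact le_limsup_of_frequently_le hev.frequently hbdd

end Summit.AnomalousDissipation.AnomalousDissipation.Theorems.ScalarAnomalySteadySourceFormal.Negative

end
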